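import Summits.BirchSwinnertonDyer.BirchSwinnertonDyer.Theorems.KolyvaginRoadThreeMethod2KolyvaginCupNonvanishing
import Summits.BirchSwinnertonDyer.BirchSwinnertonDyer.Theorems.KolyvaginRoadThreeMethod2KolyvaginLine
import Summits.BirchSwinnertonDyer.BirchSwinnertonDyer.Theorems.KolyvaginRoadThreeMethod2LocalDictionaries
import HarnessLib

/-!
# Route `KolyvaginRoadThree`, deciding crux `ZhangSharpFrameAtThreeHL` (item stmt-BirchSwinnertonDyer-19574):
# (IsoBound) in cup-product currency — REDUCTION TO THE BOTH-RAMIFIED CASE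
# (cell `bsd-stepL`, ACCEL seat `bsd-stepL-koly3b` g6; `--supports stmt-BirchSwinnertonDyer-19574`, helper; part XXIV of the
# `KolyvaginRoadThreeZhangSupply*` series)

HONEST FRAMING. One theorem; 0 definitions, 0 named facts, 0 `sorry`; closes nothing (T7). PARTITION: O2@3 (B10) × A1 ×
crux 19574 × the S2-ENGINE's (Supply) binder — proves-glue.

WHAT. The last input of `hSupply` is the local line-rigidity at a Kolyvagin prime `λ` in cup-product currency
(`hboundCup` of `hSupply_of_poitouTate`): two `c`-eigenclasses `x, y ∈ H¹(K, E[3])^{s}` whose `λ`-localisations are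
mutually and self isotropic for the local Weil cup product, the first with `loc_λ x ≠ 0`, have proportional localisations.
Following zhang3-p1 g9's case plan (HANDOFF § zhang3-p1 g9): if `x` is SELMER at `λ`, then so is `y`
(`KolyLocal.mem_selmerLocalKer_of_cupProduct_eq_zero`, p522629) and both lie on the Kummer eigen-line
(`KolyLocal.exists_kummerEigenLine`, p513538), whence proportional; if `x` is NOT Selmer and `y` is, then `loc_λ y = 0`
(`KolyLocal.cupProduct_ne_zero_of_selmer_of_not_selmer` applied to `(y, x)`). This file proves the binder from these
two landed cases plus the remaining BOTH-RAMIFIED case kept as the hypothesis `hram` (zhang3-p1 g9's (b1)+(b2):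
`apply_frob_eq_zero_of_self_cup_eq_zero` + `exists_eq_zsmul_of_apply_frob_eq_zero`).
[cite: WZhang2014, Lemma 8.4 (1), §8.1] [cite: GrossLMS1991, Prop. 8.1–8.2, 9.6] [cite: McCallumLMS1991, Lemma 5.3]
-/

noncomputable section

open scoped Classical Pointwise

namespace Summit.BirchSwinnertonDyer.Rank1Residual.X11b.Three.Koly.ZhangSupply

open CategoryTheory WeierstrassCurve Field Function NumberField IsDedekindDomain
open Literature.NumberTheory.EllipticCurves Literature.NumberTheory.EllipticCurves.ModularForms
  Literature.NumberTheory.GaloisRepresentations Module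
open Literature.NumberTheory.GaloisRepresentations.DiscreteGaloisModule (mu MuCarrier)
open Literature.NumberTheory.GaloisCohomology
open Summit.BirchSwinnertonDyer.Rank1Residual.X11b.Three.Koly.Method2
open Summit.BirchSwinnertonDyer.Rank1Residual.X11b.Three.Koly.Method2.KolyLocal
open scoped ContRepresentation

attribute [local instance] absoluteGaloisGroup_compactSpace
attribute [local instance] finite_geomTorsion_of_neZero

variable (W : WeierstrassCurve ℚ) (K : Type) [Field K] [NumberField K] [W.IsElliptic] [W.IsGloballyMinimal]

/-- **(IsoBound) in cup-product currency, from the both-ramified case.** At a Kolyvagin prime `λ ∋ ℓ` of the HL frame,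
for every Weil-type pairing `e`: if `hram` settles the case where NEITHER class is Selmer at `λ`, then for all
`c`-eigenclasses `x, y` of sign `s` with `loc_λ x ∪ loc_λ x = loc_λ x ∪ loc_λ y = loc_λ y ∪ loc_λ x = loc_λ y ∪ loc_λ y = 0`
and `loc_λ x ≠ 0`, `y − a • x ∈ torsionLocalKer_λ` for some `a ∈ ℤ`. [cite: WZhang2014, Lemma 8.4 (1)]
[cite: GrossLMS1991, Prop. 8.1–8.2] -/
theorem sub_zsmul_mem_torsionLocalKer_of_isotropic_of_ramifiedCase (hK : IsImaginaryQuadratic K)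
    (hsurj : W.HasSurjectiveModNGaloisRep 3) {c : K ≃ₐ[ℚ] K} (hc : c ≠ 1)
    (e : geomTorsion (W.baseChange K) ((3 ^ 1 : ℕ) : ℤ) → geomTorsion (W.baseChange K) ((3 ^ 1 : ℕ) : ℤ) →
      AlgebraicClosure K)
    (hμ : ∀ P Q, e P Q ^ (3 ^ 1) = 1) (hadd₁ : ∀ P₁ P₂ Q, e (P₁ + P₂) Q = e P₁ Q * e P₂ Q)
    (hadd₂ : ∀ P Q₁ Q₂, e P (Q₁ + Q₂) = e P Q₁ * e P Q₂) (halt : ∀ Q, e Q Q = 1)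
    (hnondeg : ∀ Q, (∀ P, e P Q = 1) → Q = 0)
    (hgal : ∀ (σ : absoluteGaloisGroup K) (P Q : geomTorsion (W.baseChange K) ((3 ^ 1 : ℕ) : ℤ)),
      σ • e P Q = e (σ • P) (σ • Q))
    {ℓ : ℕ} (hℓ : Zhang2014.IsKolyvaginPrime (W.conductorNorm ℤ) W K 3 ℓ) (v : HeightOneSpectrum (𝓞 K))
    (hv : (ℓ : 𝓞 K) ∈ v.asIdeal) (s : Bool)
    -- the both-ramified case
    (hram : ∀ x y : V3 W K, conjAct W c ((3 ^ 1 : ℕ) : ℤ) x = sgn s • x → conjAct W c ((3 ^ 1 : ℕ) : ℤ) y = sgn s • y →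
      x ∉ selmerLocalKer (W.baseChange K) (v.adicCompletion K) ((3 ^ 1 : ℕ) : ℤ) →
      y ∉ selmerLocalKer (W.baseChange K) (v.adicCompletion K) ((3 ^ 1 : ℕ) : ℤ) →
      (weilContPairingLocal (W.baseChange K) (3 ^ 1) e hμ hadd₁ hadd₂ hgal (Sum.inr v)).cupProduct
        (galoisCohomology.localization ((W.baseChange K).torsionGaloisModule ((3 ^ 1 : ℕ) : ℤ)) (Sum.inr v) 1 x)
        (galoisCohomology.localization ((W.baseChange K).torsionGaloisModule ((3 ^ 1 : ℕ) : ℤ)) (Sum.inr v) 1 x) = 0 →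
      (weilContPairingLocal (W.baseChange K) (3 ^ 1) e hμ hadd₁ hadd₂ hgal (Sum.inr v)).cupProduct
        (galoisCohomology.localization ((W.baseChange K).torsionGaloisModule ((3 ^ 1 : ℕ) : ℤ)) (Sum.inr v) 1 x)
        (galoisCohomology.localization ((W.baseChange K).torsionGaloisModule ((3 ^ 1 : ℕ) : ℤ)) (Sum.inr v) 1 y) = 0 →
      (weilContPairingLocal (W.baseChange K) (3 ^ 1) e hμ hadd₁ hadd₂ hgal (Sum.inr v)).cupProduct
        (galoisCohomology.localization ((W.baseChange K).torsionGaloisModule ((3 ^ 1 : ℕ) : ℤ)) (Sum.inr v) 1 y)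
        (galoisCohomology.localization ((W.baseChange K).torsionGaloisModule ((3 ^ 1 : ℕ) : ℤ)) (Sum.inr v) 1 y) = 0 →
      x ∉ (W.baseChange K).torsionLocalKer (v.adicCompletion K) ((3 ^ 1 : ℕ) : ℤ) →
      ∃ a : ℤ, y - a • x ∈ (W.baseChange K).torsionLocalKer (v.adicCompletion K) ((3 ^ 1 : ℕ) : ℤ))
    {x y : V3 W K} (hxs : conjAct W c ((3 ^ 1 : ℕ) : ℤ) x = sgn s • x) (hys : conjAct W c ((3 ^ 1 : ℕ) : ℤ) y = sgn s • y)
    (h11 : (weilContPairingLocal (W.baseChange K) (3 ^ 1) e hμ hadd₁ hadd₂ hgal (Sum.inr v)).cupProduct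
      (galoisCohomology.localization ((W.baseChange K).torsionGaloisModule ((3 ^ 1 : ℕ) : ℤ)) (Sum.inr v) 1 x)
      (galoisCohomology.localization ((W.baseChange K).torsionGaloisModule ((3 ^ 1 : ℕ) : ℤ)) (Sum.inr v) 1 x) = 0)
    (h12 : (weilContPairingLocal (W.baseChange K) (3 ^ 1) e hμ hadd₁ hadd₂ hgal (Sum.inr v)).cupProduct
      (galoisCohomology.localization ((W.baseChange K).torsionGaloisModule ((3 ^ 1 : ℕ) : ℤ)) (Sum.inr v) 1 x)
      (galoisCohomology.localization ((W.baseChange K).torsionGaloisModule ((3 ^ 1 : ℕ) : ℤ)) (Sum.inr v) 1 y) = 0)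
    (h21 : (weilContPairingLocal (W.baseChange K) (3 ^ 1) e hμ hadd₁ hadd₂ hgal (Sum.inr v)).cupProduct
      (galoisCohomology.localization ((W.baseChange K).torsionGaloisModule ((3 ^ 1 : ℕ) : ℤ)) (Sum.inr v) 1 y)
      (galoisCohomology.localization ((W.baseChange K).torsionGaloisModule ((3 ^ 1 : ℕ) : ℤ)) (Sum.inr v) 1 x) = 0)
    (h22 : (weilContPairingLocal (W.baseChange K) (3 ^ 1) e hμ hadd₁ hadd₂ hgal (Sum.inr v)).cupProduct
      (galoisCohomology.localization ((W.baseChange K).torsionGaloisModule ((3 ^ 1 : ℕ) : ℤ)) (Sum.inr v) 1 y)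
      (galoisCohomology.localization ((W.baseChange K).torsionGaloisModule ((3 ^ 1 : ℕ) : ℤ)) (Sum.inr v) 1 y) = 0)
    (hx0 : x ∉ (W.baseChange K).torsionLocalKer (v.adicCompletion K) ((3 ^ 1 : ℕ) : ℤ)) :
    ∃ a : ℤ, y - a • x ∈ (W.baseChange K).torsionLocalKer (v.adicCompletion K) ((3 ^ 1 : ℕ) : ℤ) := by
  have hker : ∀ z : V3 W K,
      galoisCohomology.localization ((W.baseChange K).torsionGaloisModule ((3 ^ 1 : ℕ) : ℤ)) (Sum.inr v) 1 z = 0 ↔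
        z ∈ (W.baseChange K).torsionLocalKer (v.adicCompletion K) ((3 ^ 1 : ℕ) : ℤ) := fun z ↦
    (mem_torsionLocalKer_iff_localization_eq_zero W K v z).symm
  by_cases hxK : x ∈ selmerLocalKer (W.baseChange K) (v.adicCompletion K) ((3 ^ 1 : ℕ) : ℤ)
  · -- `x` Selmer: `y` Selmer too, both on the Kummer eigen-line
    have hyK : y ∈ selmerLocalKer (W.baseChange K) (v.adicCompletion K) ((3 ^ 1 : ℕ) : ℤ) :=
      mem_selmerLocalKer_of_cupProduct_eq_zero W K hK hsurj hc e hμ hadd₁ hadd₂ halt hnondeg hgal hℓ v hv s hxs hys hxK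
        hx0 h12
    obtain ⟨e₀, he₀⟩ := exists_kummerEigenLine W K hK hsurj hc hℓ v hv s
    obtain ⟨a, ha⟩ := he₀ x hxs hxK
    obtain ⟨a', ha'⟩ := he₀ y hys hyK
    -- `3 e₀ = 0`, `loc x = a e₀ ≠ 0` forces `a ≢ 0 (mod 3)`, so `a² ≡ 1` and `e₀ = a • loc x`
    have h3 : (3 : ℤ) • e₀ = 0 := by
      have h := galoisCohomology.nsmul_eq_zero_of_forall (((W.baseChange K).torsionGaloisModule ((3 ^ 1 : ℕ) :
        ℤ)).toLocal (Sum.inr v)) (n := 3 ^ 1) (fun m => AddSubgroup.torsionBy.nsmul m) e₀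
      rw [← natCast_zsmul] at h
      exact_mod_cast h
    have hax0 : a • e₀ ≠ 0 := fun h ↦ hx0 ((hker x).mp (ha.trans h))
    have hsq : (a * a) • e₀ = e₀ := by
      -- `a ≡ ±1 (mod 3)`: write `a = 3q + r`, `r ∈ {1, 2}`
      have hr : a % 3 = 1 ∨ a % 3 = 2 := by
        have h0 : a % 3 ≠ 0 := by
          intro h0
          apply hax0
          obtain ⟨q, hq⟩ := Int.dvd_of_emod_eq_zero h0
          rw [hq, mul_comm, mul_zsmul, h3, zsmul_zero]
        omega
      have key : ∀ m : ℤ, m • e₀ = (m % 3) • e₀ := fun m ↦ by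
        conv_lhs => rw [← Int.emod_add_mul_ediv m 3, add_zsmul, mul_comm, mul_zsmul, h3, zsmul_zero, add_zero]
      rw [key (a * a)]
      rcases hr with h | h
      · have : a * a % 3 = 1 := by rw [Int.mul_emod, h]; norm_num
        rw [this, one_zsmul]
      · have : a * a % 3 = 1 := by rw [Int.mul_emod, h]; norm_num
        rw [this, one_zsmul]
    refine ⟨a' * a, (hker _).mp ?_⟩
    erw [map_sub, map_zsmul]
    rw [ha, ha', smul_smul, mul_assoc, ← smul_smul a', hsq, sub_self]
  · by_cases hyK : y ∈ selmerLocalKer (W.baseChange K) (v.adicCompletion K) ((3 ^ 1 : ℕ) : ℤ)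
    · -- `x` ramified, `y` Selmer: `loc y = 0`
      by_cases hy0 : y ∈ (W.baseChange K).torsionLocalKer (v.adicCompletion K) ((3 ^ 1 : ℕ) : ℤ)
      · exact ⟨0, by rwa [zero_zsmul, sub_zero]⟩
      · exact absurd h21 (cupProduct_ne_zero_of_selmer_of_not_selmer W K hK hsurj hc e hμ hadd₁ hadd₂ halt hnondeg hgal
          hℓ v hv s hys hxs hyK hy0 hxK)
    · -- both ramified
      exact hram x y hxs hys hxK hyK h11 h12 h22 hx0
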